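import Summits.QuantumFields.YangMills.Theorems.BalabanUVNodesN19KinkLowerBoundLawsCube

/-!
# YM-DAG node N19 (= NE7 proper) — THE LOWER SIDE OF THE KINK, PART 7: the UNIFORM-MOMENT currency — laws with ALL (mixed) moments
# `(½)^t`-close and equal up to order `t`, integrating `sin(ωΣ_{i≤d}|x_i|)` differently by `≥ ωd∕(20πt)`: module 129's single-mode price is two-sided

Cell `pub-ymgap`, HUMAN RULING D-0062 (Track A) ∕ D-0149 (work-bound push), R141 (C) wider-strategy seat `pub-ymgap-dag-n19-e` (strategy
s3 = ALTERNATIVE CURRENCY), generation g31, module 7 (lineage module 138).  Route `Summits/QuantumFields/YangMills/Theses/BalabanUVNodes.lean`,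
cluster item K3⁸ «SpineGivenEndpointR13SepCoPHV» (stmt-QuantumFields-27366); filed `--supports` that item `--as helper` (it proves no registered
stub).  COUNT-NEUTRAL: [folklore] over PART 6 `…N19KinkLowerBoundLawsCube` (`exists_laws_equalMoments_sin`, `abs_integral_le_of_Icc`) BY NAME and
Mathlib `Measure.map`; TOY laws; no scheme object, no Theses import; NOT a discharge claim.

CONTENT.  The lineage's UNIFORM-MOMENT currency (modules 63∕78∕129: laws whose moments of ALL orders are `r`-close) prices the single mode at
`|∫cos(ωΣ|x_i|)d(P−Q)| ≤ 248(J+1)ωd∕2^J + 9^{6(J+1)2^J}r` (module 129 `abs_integral_cos_l1Norm_sub_le_multiscale`), i.e. `≲ C·ωd·log²L∕L`,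
`L = log r⁻¹`.  THE SCALED WITNESS: push PART 6's pair (equal moments of order `≤ t`) forward by `s ↦ s∕2` (resp. `s ↦ (s∕2,…,s∕2)`): moments of
order `n ≤ t` stay equal, moments of order `n > t` are `≤ (½)^n` each, so ALL (mixed) moments are `2(½)^{t+1} = (½)^t`-close, while
`∫sin(a|x|)` becomes `∫sin((a∕2)|s|)` — paid `(a∕2)∕(10πt)`:
§1 `measurable_halfDiag` · `integral_map_halfDiag` · `map_halfDiag_cube_compl` · `abs_integral_pow_half_le`;
§2 ★★★ `exists_laws_closeMixedMoments_sin_l1Norm` — for `t ≥ 6`, `ω ≥ 0`, `ω|ι| ≤ t∕5`: probability laws `P, Q` on `[−1,1]^ι` with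
`|∫∏x_i^{j_i}dP − ∫∏x_i^{j_i}dQ| ≤ (½)^t` for EVERY exponent vector `j` (equality when `Σj_i ≤ t`) and `∫sin(ωΣ|x_i|)dQ − ∫sin(ωΣ|x_i|)dP ≥ ω|ι|∕(20πt)`.
READING: at closeness `r = 2^{−t}` (`L = t·log 2`) the single mode of `d` strings is paid `≥ ωd·log 2∕(20πL)` by some pair of `r`-close laws — module
129's `≲ C·ωd·log²L∕L` is sharp up to `log²L` (and module 116's `(cosh ωd − 1)·96∕(1+L)` up to its exponential prefactor); the UNIFORM-MOMENT row of the
single mode is TWO-SIDED.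

HONEST FRAMING (binding).  Elementary and [folklore]; TOY laws; NO consumer in the DAG today (an optimality map of the seat's own currency);
nothing of Bałaban's instantiated; NE7 NOT PRINTED, NOT proved; N19 NOT discharged; count-neutral.  One finite `T⁴` programme at fixed `ε`;
nothing continuum ∕ `ℝ⁴` ∕ OS ∕ mass-gap ∕ Clay.  Constants not optimised.  0 `def` ∕ 0 `sorry`.
-/

noncomputable section

open Finset Real MeasureTheory Polynomial

namespace Summit.QuantumFields.YangMills.Theorems.BalabanUVNodesN19KinkLowerBoundMomentCurrency

open Summit.QuantumFields.YangMills.Theorems.BalabanUVNodesN19KinkLowerBoundLawsCube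
  (exists_laws_equalMoments_sin abs_integral_le_of_Icc)

variable {ι : Type*} [Fintype ι]

/-! ## §1 The half-scale diagonal push-forward `s ↦ (s∕2,…,s∕2)` [bookkeeping] -/

omit [Fintype ι] in
/-- The half-scale diagonal map is measurable. [bookkeeping] -/
theorem measurable_halfDiag : Measurable fun s : ℝ => fun _ : ι => s / 2 :=
  measurable_pi_lambda _ fun _ => measurable_id.div_const _

/-- Integration against the half-scale diagonal push-forward (continuous integrand). [bookkeeping] -/
theorem integral_map_halfDiag (P : Measure ℝ) {g : (ι → ℝ) → ℝ} (hg : Continuous g) :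
    ∫ x, g x ∂(P.map fun s : ℝ => fun _ : ι => s / 2) = ∫ s, g (fun _ : ι => s / 2) ∂P :=
  MeasureTheory.integral_map (measurable_halfDiag (ι := ι)).aemeasurable hg.aestronglyMeasurable

/-- The half-scale diagonal push-forward of a law carried by `[−1,1]` is carried by the cube. [bookkeeping] -/
theorem map_halfDiag_cube_compl {P : Measure ℝ} (hP : P (Set.Icc (-1 : ℝ) 1)ᶜ = 0) :
    (P.map fun s : ℝ => fun _ : ι => s / 2) (Set.pi Set.univ (fun _ : ι => Set.Icc (-1 : ℝ) 1))ᶜ = 0 := by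
  rw [Measure.map_apply (measurable_halfDiag (ι := ι)) (MeasurableSet.univ_pi fun _ => measurableSet_Icc).compl]
  refine measure_mono_null (fun s hs => ?_) hP
  simp only [Set.mem_preimage, Set.mem_compl_iff, Set.mem_univ_pi, not_forall, Set.mem_Icc, not_and_or, not_le] at hs ⊢
  obtain ⟨_, hi⟩ := hs
  rcases hi with hi | hi
  · left; linarith
  · right; linarith

omit [Fintype ι] in
/-- The half-scale diagonal push-forward of a probability law is a probability law. [bookkeeping] -/
theorem isProbabilityMeasure_map_halfDiag (P : Measure ℝ) [IsProbabilityMeasure P] :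
    IsProbabilityMeasure (P.map fun s : ℝ => fun _ : ι => s / 2) :=
  Measure.isProbabilityMeasure_map (measurable_halfDiag (ι := ι)).aemeasurable

/-- High moments after halving: `|∫(s∕2)^n dP| ≤ (½)^n` for a probability law on `[−1,1]`. [bookkeeping] -/
theorem abs_integral_pow_half_le {P : Measure ℝ} [IsProbabilityMeasure P] (hP : P (Set.Icc (-1 : ℝ) 1)ᶜ = 0) (n : ℕ) :
    |∫ s, (s / 2) ^ n ∂P| ≤ (1 / 2 : ℝ) ^ n := by
  refine abs_integral_le_of_Icc hP fun s hs => ?_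
  rw [abs_pow, abs_div, abs_two, div_pow, div_pow, one_pow]
  exact div_le_div_of_nonneg_right (pow_le_one₀ (abs_nonneg s) (abs_le.2 ⟨hs.1, hs.2⟩)) (by positivity)

/-! ## §2 The witness for the uniform-moment currency [folklore] -/

/-- ★★★ **LAWS WITH ALL MIXED MOMENTS `(½)^t`-CLOSE, DISAGREEING ON THE SINGLE MODE.**  For `t ≥ 6`, `ω ≥ 0` with `ω|ι| ≤ t∕5` there are probability
laws `P, Q` on `[−1,1]^ι` with `∫∏x_i^{j_i}dP = ∫∏x_i^{j_i}dQ` whenever `Σ_i j_i ≤ t`, `|∫∏x_i^{j_i}dP − ∫∏x_i^{j_i}dQ| ≤ (½)^t` for EVERY `j`, and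
`∫sin(ωΣ_i|x_i|)dQ − ∫sin(ωΣ_i|x_i|)dP ≥ ω|ι|∕(20πt)` (PART 6's pair pushed forward by `s ↦ (s∕2,…,s∕2)`). [folklore] -/
theorem exists_laws_closeMixedMoments_sin_l1Norm {t : ℕ} (ht : 6 ≤ t) {ω : ℝ} (hω : 0 ≤ ω)
    (hωd : ω * Fintype.card ι ≤ t / 5) :
    ∃ P Q : Measure (ι → ℝ), IsProbabilityMeasure P ∧ IsProbabilityMeasure Q ∧
      P (Set.pi Set.univ (fun _ : ι => Set.Icc (-1 : ℝ) 1))ᶜ = 0 ∧ Q (Set.pi Set.univ (fun _ : ι => Set.Icc (-1 : ℝ) 1))ᶜ = 0 ∧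
      (∀ j : ι → ℕ, ∑ i, j i ≤ t → ∫ x, ∏ i, x i ^ j i ∂P = ∫ x, ∏ i, x i ^ j i ∂Q) ∧
      (∀ j : ι → ℕ, |(∫ x, ∏ i, x i ^ j i ∂P) - ∫ x, ∏ i, x i ^ j i ∂Q| ≤ (1 / 2 : ℝ) ^ t) ∧
      ω * Fintype.card ι / (20 * π * t) ≤
        (∫ x, Real.sin (ω * ∑ i, |x i|) ∂Q) - ∫ x, Real.sin (ω * ∑ i, |x i|) ∂P := by
  obtain ⟨P, Q, iP, iQ, hPc, hQc, hmom, hsin⟩ := exists_laws_equalMoments_sin ht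
  have hc : ∀ j : ι → ℕ, Continuous fun x : ι → ℝ => ∏ i, x i ^ j i := fun j => by fun_prop
  have hpow : ∀ (j : ι → ℕ) (s : ℝ), ∏ i, (fun _ : ι => s / 2) i ^ j i = (s / 2) ^ (∑ i, j i) := fun j s => by
    rw [Finset.prod_pow_eq_pow_sum]
  have hpoly : ∀ (n : ℕ) (s : ℝ), (s / 2) ^ n = (Polynomial.C ((2 : ℝ) ^ n)⁻¹ * Polynomial.X ^ n : ℝ[X]).eval s := fun n s => by
    rw [Polynomial.eval_mul, Polynomial.eval_C, Polynomial.eval_pow, Polynomial.eval_X, div_pow]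
    ring
  have hmomEq : ∀ j : ι → ℕ, ∑ i, j i ≤ t →
      ∫ x, ∏ i, x i ^ j i ∂(P.map fun s : ℝ => fun _ : ι => s / 2) =
        ∫ x, ∏ i, x i ^ j i ∂(Q.map fun s : ℝ => fun _ : ι => s / 2) := by
    intro j hj
    rw [integral_map_halfDiag P (hc j), integral_map_halfDiag Q (hc j)]
    simp_rw [hpow j, hpoly]
    refine hmom _ ((Polynomial.natDegree_C_mul_le _ _).trans ?_)
    rwa [Polynomial.natDegree_X_pow]
  refine ⟨P.map fun s : ℝ => fun _ : ι => s / 2, Q.map fun s : ℝ => fun _ : ι => s / 2, isProbabilityMeasure_map_halfDiag P,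
    isProbabilityMeasure_map_halfDiag Q, map_halfDiag_cube_compl hPc, map_halfDiag_cube_compl hQc, hmomEq, fun j => ?_, ?_⟩
  · by_cases hj : ∑ i, j i ≤ t
    · rw [hmomEq j hj, sub_self, abs_zero]
      positivity
    · rw [integral_map_halfDiag P (hc j), integral_map_halfDiag Q (hc j)]
      simp_rw [hpow j]
      have hn : t + 1 ≤ ∑ i, j i := by omega
      have h1 := abs_integral_pow_half_le hPc (∑ i, j i)
      have h2 := abs_integral_pow_half_le hQc (∑ i, j i)
      have hle : (1 / 2 : ℝ) ^ (∑ i, j i) ≤ (1 / 2 : ℝ) ^ (t + 1) := pow_le_pow_of_le_one (by norm_num) (by norm_num) hn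
      calc |(∫ s, (s / 2) ^ (∑ i, j i) ∂P) - ∫ s, (s / 2) ^ (∑ i, j i) ∂Q|
          ≤ |∫ s, (s / 2) ^ (∑ i, j i) ∂P| + |∫ s, (s / 2) ^ (∑ i, j i) ∂Q| := abs_sub _ _
        _ ≤ (1 / 2 : ℝ) ^ (t + 1) + (1 / 2 : ℝ) ^ (t + 1) := add_le_add (h1.trans hle) (h2.trans hle)
        _ = (1 / 2 : ℝ) ^ t := by rw [pow_succ]; ring
  · have hcs : Continuous fun x : ι → ℝ => Real.sin (ω * ∑ i, |x i|) := by fun_prop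
    rw [integral_map_halfDiag P hcs, integral_map_halfDiag Q hcs]
    have hsum : ∀ s : ℝ, Real.sin (ω * ∑ _i : ι, |(fun _ : ι => s / 2) _i|) =
        Real.sin (ω * Fintype.card ι / 2 * |s|) := fun s => by
      rw [Finset.sum_const, Finset.card_univ, nsmul_eq_mul, abs_div, abs_two]
      ring_nf
    simp_rw [hsum]
    have h := hsin (ω * Fintype.card ι / 2) (by positivity) (by linarith)
    have he : ω * Fintype.card ι / 2 / (10 * π * t) = ω * Fintype.card ι / (20 * π * t) := by ring
    rw [he] at h
    exact h

end Summit.QuantumFields.YangMills.Theorems.BalabanUVNodesN19KinkLowerBoundMomentCurrency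

end
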